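import Summits.QuantumFields.YangMills.Theorems.BalabanUVNodesN05SubBP2DPerKappaSlotExistsOfThm33JunctionHWithQQPP6Guarded
import Literature.MathematicalPhysics.QuantumFieldTheory.Balaban1983to89.B9SupplySockB9P3ZdInstance
import Literature.MathematicalPhysics.QuantumFieldTheory.Balaban1983to89.B9SupplySockB9P3ZdLocalLettersOfOps
import Literature.MathematicalPhysics.QuantumFieldTheory.Balaban1983to89.B9SupplySockB9P3ZdGammaInAkDpZd

/-!
# BalabanUVNodes ∕ N05 ([Balaban1985RegularSpaces] Lemma 1 p. 79 – Thm 8 p. 101, (1.3)–(1.5) p. 77, p. 77 «Ω_j ⊂ T_η»): P4 — THE J-N06→N05 JUNCTION ON THE (β′-PERIODIC)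
# κ-CUT ROAD, PART 3 of 3: AT N06's `ℤᵈ` FRAME OF RECORD (`geoZd`, `bgZd`, `GAZdFamOfOps`, `ιLocZd`; `hdict` ∕ `hcurv` discharged) — THE ROW THE A-5′ (ii) CLOSER READS

Track A of `YM-PLAN.md` (cell `pub-ymgap`, HUMAN RULING D-0062), node **N05**; seat `pub-ymgap-dag-n05-d` (g14, P4 pen), 2026-08-28; bears on K1⁹ `stmt-QuantumFields-27364`
(`--supports … --as helper`, count-neutral).

WHAT.  `BalabanUVNodesN05SubBP2DPerKappaSlotExistsOfThm33JunctionHAtZdFrameGuarded` (p640747) RE-RUN, token for token by `gen_junction_per.py` on the tree bytes, on part 2's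
κ-periodic `…_withQQP_P6(I)_guarded`: hypotheses VERBATIM (SIX binders `InvAtH ∕ LandauAt ∕ HolderAtδ2 ∕ LinBddAt ∕ SrcAt ∕ SrcHolderAtδ2` at every `j : Node00.IdxB8SubD θ`,
N06's `B9.Thm33Printed` at the frame of record, the letter pin `hops`); the inner conclusion gains `∀ (Pκ Mκ Rκ : ℕ),` and reads
`∃ lam c₁ ρ₀ ax, 0 < c₁ ∧ 1 ≤ ρ₀ ∧ B8LeafOfRecordSubBP₂DPerκ θ Pκ Mκ Rκ ⟨lam.cutSubBP₅ c₁ ρ₀, ax⟩` — at `Pκ := Mκ·θ.L` this is the A-5′ (ii) λ-term's body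
`∃ lam8, Slot8κ Mκ Rκ θ lam8` (dag-n24-w1 (R1) ∕ dag-n05-w1 ∕ this seat, cell bus 2026-08-28) up to `⟨Mκ·θ.L, ⟨pos, dvd_rfl⟩⟩`.
* §5 ★★★ `…_zdFrame_guarded` — SIX binders at N06's frame of record ⊢ the κ-periodic row under Prop. 6's constants.
* §6 ★★★ `…_zdFrameI_guarded` — the index-generic edition (`π`, `mem`, `hmem`) ⊢ the same.
* §7 ★★★ `exists_residB8_slot8κ_of_letters_thm33_junctionH_zdFrame_guarded` — §5 at `Pκ := Mκ·θ.L`, `1 ≤ Mκ`: the A-5′ (ii) λ-term's body `∃ lam8, Slot8κ Mκ Rκ θ lam8` LITERALLY.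
HONEST FRAMING: composition BY NAME; 0 estimates; the SIX binders + `h33` are N06 content at the ℤᵈ-keyed (1.3)–(1.5) members (`m ≥ 1` OPEN; class-wide satisfiability NOT
claimed — the CLASS NOTE of p633678 applies verbatim; the outer re-index of the binders to `IdxB8SubDPerκ` members at the pinned `Mκ` is NOT done here); p7 slot
junk-inhabited (census); count-neutral; **N05 NOT discharged** by this file; K1⁹ NOT claimed; FLAG №10 NOT closed (A-5′ (ii) is dag-n24-w1's instance); Bałaban AS
PRINTED (Thm 8 SURVIVING form, GAPS G-B8-13; `T_η` as `P`-periodic data on `ℤᵈ`); one finite 𝕋⁴ programme at fixed ε; nothing continuum ∕ ℝ⁴ ∕ OS ∕ mass-gap ∕ Clay.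
No `sorry`, no new definition.  Unit `pub-ymgap-dag-n05-d` (g14).
[cite: Balaban1985RegularSpaces, Lemma 1 – Thm 8 pp.79–101, (1.3)–(1.5) p.77, p.77 («Ω_j ⊂ T_η»), (1.59) p.86; Balaban1985BackgroundPropagators, (3.10) p.392, (3.41) p.397, (3.47) p.398, Thm 3.3 p.399, (3.69) p.404]
-/

noncomputable section

namespace Summit.QuantumFields.YangMills.BalabanUVNodes.N05SubBP2DPerKappaSlotExistsOfThm33JunctionHAtZdFrameGuarded

open Literature.MathematicalPhysics.QuantumFieldTheory.Balaban1983to89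
open Literature.MathematicalPhysics.QuantumFieldTheory.Balaban1983to89.Node00
open Literature.MathematicalPhysics.QuantumFieldTheory.Balaban1983to89.B8IdxB8LawsB (IdxB8LawsB)
open Literature.MathematicalPhysics.QuantumFieldTheory.Balaban1983to89.B8LeafModelZd (ZdIdx)
open Literature.MathematicalPhysics.QuantumFieldTheory.Balaban1983to89.B8TowerBondsPrinted (towerBondsP)
open Literature.MathematicalPhysics.QuantumFieldTheory.Balaban1983to89.B8SockLettersRD (SockLettersRD)
open Literature.MathematicalPhysics.QuantumFieldTheory.Balaban1983to89.B8Eq138LandauZd (covLap QT)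
open B7Prop1Explicit B7Prop2Explicit B7Prop1Local
open B8Ineq132 (InAk covDerivFwd)
open B7Eq78Linearization (zdBlocking QprimeIter)
open B8Eq119TwistedAxial (bgT)
open B8Eq140Level (SideTouches)
open B8Eq1117Concrete (XSpace)
open B8Prop5ContractionKLevel (Bd2)
open B8LambdaSpaceKLevel (wt)
open B9SupplySockB9P3ZdLetters (OpsZd DictGlob)
open B9SupplySockB9P3ZdAt (DictAt LandauAt SrcAt dictAt_of_global)
open B9SupplySockB9P3ZdAtLin (LinBddAt)
open B9SupplySockB9P3ZdGammaUnivDelta2 (HolderAtδ2)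
open B9SupplySockB9P3ZdAtHerm (InvAtH)
open B9SupplySockB9P3ZdGammaUnivDelta2Src (SrcHolderAtδ2)
open B9SupplySockB9P3ZdFrame (MemberZd memZd bgZd ιCfgZd geoZd ιLocZd)
open B9SupplySockB9P3ZdLocalLettersOfOps (GAZdFamOfOps GAZdFamOfOps_eq)
open B9SupplySockB9P3ZdInstance (dictGlob_zd)
open B9SupplySockB9P3ZdGammaInAkDpZd (withDpZd withDpZd_Dp curvAtInAk_of_Dp_eq)
open B9Eq369CurvSmallZd (DpZd)
open B9Eq316AveragingTransposeZdPrinted (withQQP withQQP_Dp)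
open Summit.QuantumFields.YangMills.BalabanUVNodes.N05SubBP2DPerKappaSlotExistsOfThm33JunctionHWithQQPP6Guarded
  (exists_residB8_b8LeafOfRecordSubBP₂DPerκ_cutSubBP₅_of_letters_thm33_junctionH_withQQP_P6_guarded
    exists_residB8_b8LeafOfRecordSubBP₂DPerκ_cutSubBP₅_of_letters_thm33_junctionH_withQQP_P6I_guarded)
-- `Site` alone could resolve to the torus sites of `Setup.lean`; re-export the `ℤ^d` sites of `B7Prop1Explicit`.

export B7Prop1Explicit (Site)

section AtZdFrameGuarded

/-- ★★★ **(β′-PERIODIC κ-CUT ROAD; director-ym №222 A-5′) GUARDED EDITION** (the witness CARRIES `0 < c₁ ∧ 1 ≤ ρ₀` — director-ym №217 (2)(i), ref-D VERDICT-415) of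
★★★ **THE J-N06→N05 JUNCTION APPLIED ON THE «P₂D» ROAD AT N06's FULL `ℤᵈ` FRAME OF RECORD, THE DICTIONARY AND THE (3.69) BINDERS DISCHARGED** — for `θ` with
`2 ≤ θ.D`, `5 ≤ θ.L`: Proposition 6 produces `c35₀, M₆ > 0` such that for every leaf constant `c35 ≥ c35₀` and every junction floor `M₃ ≥ M₆`, [4]'s letters `SLet ∕ SLetUB`,
any length function `len`, any (3.8)-family `Gp`, any letter family `ops` whose `Q*aQ` and `Δ′(U₀)` letters are the genuine ones (`hops`), N06's node sentence
`B9.Thm33Printed c35 (geoZd θ.𝔸 θ.L len) (bgZd θ.𝔸 θ.L) Gp (GAZdFamOfOps θ.𝔸 θ.L len ops)`, and the SIX junction binders `InvAtH ∕ LandauAt ∕ HolderAtδ2 ∕ LinBddAt ∕ SrcAt ∕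
SrcHolderAtδ2` at every `j : Node00.IdxB8SubD θ` give the N05 row `∃ lam c₁ ρ₀ ax, 0 < c₁ ∧ 1 ≤ ρ₀ ∧ B8LeafOfRecordSubBP₂DPerκ θ Pκ Mκ Rκ ⟨lam.cutSubBP₅ c₁ ρ₀, ax⟩` (every period `Pκ`, every pinned pair `(Mκ, Rκ)`; dag-n05-w1's κ-cut periodic δ₂-slot).  Proof: dag-n05-e's `…_P6` at
`(geo, GA, ιLoc) := (geoZd, GAZdFamOfOps ops, ιLocZd)`, `ops₀ := withDpZd ops₀`, with `hdict := dictAt_of_global (dictGlob_zd …)` and `hcurv := curvAtInAk_of_Dp_eq …`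
(`c69 := 14(D−1)`).  Hypotheses are N06 content; N05 NOT discharged.
[cite: Balaban1985RegularSpaces, Lemma 1 – Thm 8 pp.79–101, (1.3)–(1.5) p.77, (1.59) p.86; Balaban1985BackgroundPropagators, (3.10) p.392, (3.41) p.397, (3.47) p.398, Thm 3.3 p.399, (3.69) p.404] -/
theorem exists_residB8_b8LeafOfRecordSubBP₂DPerκ_cutSubBP₅_of_letters_thm33_junctionH_zdFrame_guarded (θ : Stage3Params) (hD : 2 ≤ θ.D) (hL5 : 5 ≤ θ.L)
    [FiniteDimensional ℝ θ.𝔸] :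
    ∃ c35₀ M₆ : ℝ, 0 < c35₀ ∧ 0 < M₆ ∧
      ∀ ⦃c35 : ℝ⦄, c35₀ ≤ c35 → ∀ ⦃M₃ : ℝ⦄, M₆ ≤ M₃ →
      -- [Balaban1985BackgroundPropagators] Thm 3.1's letter bounds and threshold
      ∀ {B₀'H B₂' BG BR cL : ℝ}, 0 < B₀'H → 0 ≤ B₂' → 0 ≤ BG → 0 ≤ BR → 0 < cL →
      -- [4]'s letters AT THE (1.3)–(1.5)-ADMISSIBLE `Ω₀ = ℤᵈ` LAW MEMBERS (p619291's texts verbatim): existence side and uniqueness side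
      (∀ i : ZdIdx θ.D θ.L, i.Ω 0 = Set.univ → IdxB8LawsB θ.L i → B8ConstraintBonds.DomainSeq θ.L i.Ω → (∀ l, l < i.k → ∀ z ∈ i.Λs i.k l, ((θ.L : ℤ) ^ l) • z ∈ B8ConstraintBonds.Lam θ.L i.Ω l) → SockLettersRD (𝔸 := θ.𝔸) θ.L BG BR B₀'H B₂' cL i.η i.k i.Ω i.Λs) →
      (∀ i : ZdIdx θ.D θ.L, i.Ω 0 = Set.univ → IdxB8LawsB θ.L i → B8ConstraintBonds.DomainSeq θ.L i.Ω → (∀ l, l < i.k → ∀ z ∈ i.Λs i.k l, ((θ.L : ℤ) ^ l) • z ∈ B8ConstraintBonds.Lam θ.L i.Ω l) → ∀ α₀ : ℝ, 0 < α₀ → α₀ ≤ cL → ∀ U₀ : Site θ.D → Fin θ.D → θ.𝔸ˣ, (∀ x κ, U₀ x κ ∈ unitaryUnits θ.𝔸) →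
        InAk θ.L i.k i.η α₀ i.Ω U₀ →
        ∃ (g Δ : (Site θ.D → θ.𝔸) →ₗ[ℂ] (Site θ.D → θ.𝔸)) (q : (Site θ.D → θ.𝔸) →ₗ[ℂ] (ℕ → Site θ.D → θ.𝔸))
          (qs : (ℕ → Site θ.D → θ.𝔸) →ₗ[ℂ] (Site θ.D → θ.𝔸)) (Aw c : (ℕ → Site θ.D → θ.𝔸) →ₗ[ℂ] (ℕ → Site θ.D → θ.𝔸))
          (H' : XSpace θ.D i.k θ.𝔸 →ₗ[ℂ] (Site θ.D → θ.𝔸)),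
          (∀ x : Site θ.D → θ.𝔸, (∃ C : ℝ, ∀ y, ‖x y‖ ≤ C) → g (Δ x + qs (Aw (q x))) = x) ∧ (∀ φ, qs (c (q (g (g (qs φ))))) = qs φ) ∧
          (∀ (f : Site θ.D → θ.𝔸), ∀ x ∈ i.Ω 0, Δ f x = covLap i.η U₀ ((i.Ω 0).indicator f) x) ∧
          (∀ (μ : ℕ → Site θ.D → θ.𝔸), ∀ x ∈ i.Ω 0, qs μ x = QT θ.L i.k (i.Λs i.k) U₀ μ x) ∧
          (∀ (f : Site θ.D → θ.𝔸) (n : ℕ), n ≤ i.k → ∀ y ∈ i.Λs i.k n, q f n y = QprimeIter (zdBlocking θ.D θ.L) (bgT θ.L U₀) n f y) ∧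
          (∀ (f : Site θ.D → θ.𝔸) (n : ℕ) (y : Site θ.D), ¬ (n ≤ i.k ∧ y ∈ i.Λs i.k n) → q f n y = 0) ∧
          (∀ (X : XSpace θ.D i.k θ.𝔸) (x : Site θ.D), ‖H' X x‖ ≤ B₀'H * ‖X‖) ∧
          (∀ n, n ≤ i.k → ∀ (X : XSpace θ.D i.k θ.𝔸), ∀ p ∈ {b : Site θ.D × Fin θ.D | SideTouches (i.Ω n) b.1 b.2},
            wt θ.L i.η n * ‖covDerivFwd i.η U₀ p.2 (H' X) p.1‖ ≤ B₀'H * ‖X‖) ∧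
          (∀ X : XSpace θ.D i.k θ.𝔸, Bd2 θ.L i.η i.k i.Ω (covLap i.η U₀ (H' X)) (B₂' * ‖X‖)) ∧
          (∀ (Y : XSpace θ.D i.k θ.𝔸) (n : ℕ) (hn : n ≤ i.k) (y : Site θ.D), y ∈ i.Λs i.k n →
            QprimeIter (zdBlocking θ.D θ.L) (bgT θ.L U₀) n (H' Y) y = Y (⟨n, Nat.lt_succ_of_le hn⟩, y)) ∧
          (∀ (f : Site θ.D → θ.𝔸) (r : ℝ), 0 ≤ r → Bd2 θ.L i.η i.k i.Ω f r →
            (∀ x, ‖g f x‖ ≤ BG * r) ∧ ∀ n, n ≤ i.k → ∀ p ∈ {b : Site θ.D × Fin θ.D | SideTouches (i.Ω n) b.1 b.2},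
              wt θ.L i.η n * ‖covDerivFwd i.η U₀ p.2 (g f) p.1‖ ≤ BG * r) ∧
          (∀ (f : Site θ.D → θ.𝔸) (r : ℝ), 0 ≤ r → Bd2 θ.L i.η i.k i.Ω f r → Bd2 θ.L i.η i.k i.Ω (f - g (qs (c (q (g f))))) (BR * r))) →
      -- N06's `ℤᵈ` FRAME OF RECORD (dag-n06-e): lengths `len`, geometries `geoZd`, backgrounds `bgZd`, the kernel family `GAZdFamOfOps … ops` READ OFF the letters `ops`
      -- (dag-n06-e's `B9SupplySockB9P3ZdLocalLettersOfOps`), locality map `ιLocZd`; the (3.8)-side family `Gp` of Theorems 3.1–3.2 stays free (read by `Thm33Printed` only)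
      ∀ (len : Site θ.D → ℝ) (Gp : ∀ x, B9.KernelFamily (geoZd θ.𝔸 θ.L len x) (bgZd θ.𝔸 θ.L x))
        (ops : ℝ → ZdIdx θ.D θ.L → ℕ → OpsZd θ.D θ.𝔸)
      -- THE GENUINE AVERAGING LETTER `Q*aQ` (EDITION P, dag-n06-b) AND THE GENUINE CURVATURE LETTER `Δ′(U₀)` (dag-n06-w2's `withDpZd`), pinned pointwise
        (τ : θ.𝔸 →ₗ[ℂ] ℂ) {Cτ : ℝ}, (∀ x y : θ.𝔸, |(τ (star x * y)).re| ≤ Cτ * ‖x‖ * ‖y‖) →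
      ∀ (ops₀ : ℝ → ZdIdx θ.D θ.L → ℕ → OpsZd θ.D θ.𝔸),
        (∀ (M : ℝ) (i : ZdIdx θ.D θ.L) (m : ℕ), ops M i m = withQQP τ θ.L (fun m' l => towerBondsP θ.L i.Ω (i.Λs m') l) (withDpZd ops₀) M i m) →
      ∀ {a₃ β cS cSβ : ℝ} {CH : ℝ → ℝ},
      -- N06's THEOREM 3.3 AS PRINTED — ITS NODE SENTENCE (γ) AT THE `ℤᵈ` FRAME OF RECORD, VERBATIM (the kernel family of `G(U₀)` read off `ops`)
        B9.Thm33Printed c35 (geoZd θ.𝔸 θ.L len) (bgZd θ.𝔸 θ.L) Gp (GAZdFamOfOps θ.𝔸 θ.L len ops) →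
      -- dag-n06-b's JUNCTION BINDERS at the (1.3)–(1.5)-admissible members, guarded — SIX of them: NO `havg` (dag-n05-d g13 C), NO `hP6` (dag-n05-e), NO `hdict`, NO `hcurv` (this file)
        (∀ (M : ℝ) (j : IdxB8SubD θ) (m : ℕ), 1 ≤ M → M₃ ≤ M → m ≤ j.1.1.1.1.k → InvAtH (bgZd θ.𝔸 θ.L) θ.L memZd (ιCfgZd θ.𝔸 θ.L) ops c35 a₃ M j.1.1.1.1 m) →
        (∀ (M : ℝ) (j : IdxB8SubD θ) (m : ℕ), 1 ≤ M → M₃ ≤ M → m ≤ j.1.1.1.1.k → LandauAt (bgZd θ.𝔸 θ.L) θ.L memZd (ιCfgZd θ.𝔸 θ.L) ops c35 a₃ M j.1.1.1.1 m) →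
        (∀ (M : ℝ) (j : IdxB8SubD θ) (m : ℕ), 1 ≤ M → M₃ ≤ M → m ≤ j.1.1.1.1.k → HolderAtδ2 (geoZd θ.𝔸 θ.L len) (bgZd θ.𝔸 θ.L) (GAZdFamOfOps θ.𝔸 θ.L len ops) θ.L memZd (ιCfgZd θ.𝔸 θ.L) ops β len CH M j.1.1.1.1 m) →
        (∀ (M : ℝ) (j : IdxB8SubD θ) (m : ℕ), 1 ≤ M → M₃ ≤ M → m ≤ j.1.1.1.1.k → LinBddAt θ.L ops M j.1.1.1.1 m) →
        (∀ (M : ℝ) (j : IdxB8SubD θ) (m : ℕ), 1 ≤ M → M₃ ≤ M → m ≤ j.1.1.1.1.k → SrcAt (bgZd θ.𝔸 θ.L) θ.L memZd (ιCfgZd θ.𝔸 θ.L) ops c35 a₃ cS M j.1.1.1.1 m) →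
        (∀ (M : ℝ) (j : IdxB8SubD θ) (m : ℕ), 1 ≤ M → M₃ ≤ M → m ≤ j.1.1.1.1.k → SrcHolderAtδ2 (bgZd θ.𝔸 θ.L) θ.L memZd (ιCfgZd θ.𝔸 θ.L) ops c35 a₃ β len cSβ M j.1.1.1.1 m) →
      -- the junction's primitive constants ((3.27) `a₃`, source `c_S c_Sβ`; (3.69)'s `c69` is now `14(D−1)`, dag-n06-w2) and Theorem 8's source size factor `γ₈`
        0 < a₃ → 0 ≤ cS → 0 ≤ cSβ → ∀ {γ₈ : ℝ}, 1 ≤ γ₈ →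
        ∀ (Pκ Mκ Rκ : ℕ), ∃ (lam : ResidB8 θ) (c₁ : ℝ) (ρ₀ : ℕ)
          (ax : ∀ j : IdxB8SubDPer θ Pκ, (famB8OfRecordPer θ (lam.cutSubBP₅ c₁ ρ₀).β (lam.cutSubBP₅ c₁ ρ₀).len Pκ j).Cfg →
            (famB8OfRecordPer θ (lam.cutSubBP₅ c₁ ρ₀).β (lam.cutSubBP₅ c₁ ρ₀).len Pκ j).Pert → (famB8OfRecordPer θ (lam.cutSubBP₅ c₁ ρ₀).β (lam.cutSubBP₅ c₁ ρ₀).len Pκ j).Pert),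
          0 < c₁ ∧ 1 ≤ ρ₀ ∧ B8LeafOfRecordSubBP₂DPerκ θ Pκ Mκ Rκ ⟨lam.cutSubBP₅ c₁ ρ₀, ax⟩ := by
  have hL1 : 1 ≤ θ.L := le_trans (by norm_num) hL5
  -- dag-n05-e's P₆-discharged row at an ABSTRACT half-frame
  obtain ⟨c35₀, M₆, hc35₀, hM₆, H⟩ :=
    exists_residB8_b8LeafOfRecordSubBP₂DPerκ_cutSubBP₅_of_letters_thm33_junctionH_withQQP_P6_guarded θ hD hL5
  refine ⟨c35₀, M₆, hc35₀, hM₆, ?_⟩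
  intro c35 hc35 M₃ hM₃ B₀'H B₂' BG BR cL hB₀'H hB₂' hBG hBR hcL SLet SLetUB len Gp ops τ Cτ hCτ ops₀ hops a₃ β cS cSβ CH
    h33 hinv hlan hhol hlin hsrc hsrcH ha₃ hcS hcSβ γ₈ hγ₈ Pκ Mκ Rκ
  -- THE NORM DICTIONARY IS A THEOREM AT N06's FRAME OF RECORD, for THIS `ops` (dag-n06-e `dictGlob_zd`, read through `GAZdFamOfOps_eq`)
  have hDG : DictGlob (geoZd θ.𝔸 θ.L len) (bgZd θ.𝔸 θ.L) (GAZdFamOfOps θ.𝔸 θ.L len ops) θ.L memZd (ιCfgZd θ.𝔸 θ.L) (ιLocZd θ.𝔸 θ.L len) ops := by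
    rw [GAZdFamOfOps_eq]
    exact dictGlob_zd len ops _
  -- THE CURVATURE LETTER IS GENUINE AT EVERY MEMBER (the pin, dag-n06-b `withQQP_Dp`, dag-n06-w2 `withDpZd_Dp`)
  have hDp : ∀ (M : ℝ) (i : ZdIdx θ.D θ.L) (m : ℕ), (ops M i m).Dp = DpZd i.η := fun M i m => by
    rw [hops, withQQP_Dp, withDpZd_Dp]
  exact H hc35 hM₃ hB₀'H hB₂' hBG hBR hcL SLet SLetUB (geoZd θ.𝔸 θ.L len) Gp (GAZdFamOfOps θ.𝔸 θ.L len ops) (ιLocZd θ.𝔸 θ.L len) ops τ hCτ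
    (withDpZd ops₀) hops h33 (fun M j m _ _ _ => dictAt_of_global hDG M j.1.1.1.1 m) hinv
    (fun M j m hM1 _ _ => curvAtInAk_of_Dp_eq hL1 hDp hM1 j.1.1.1.1 m) hlan hhol hlin hsrc hsrcH ha₃ (by positivity) hcS hcSβ hγ₈ Pκ Mκ Rκ

end AtZdFrameGuarded

section AtZdFrameIGuarded


/-- ★★★ **(β′-PERIODIC κ-CUT ROAD; director-ym №222 A-5′) GUARDED EDITION** (the witness CARRIES `0 < c₁ ∧ 1 ≤ ρ₀` — director-ym №217 (2)(i), ref-D VERDICT-415) of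
★★★ **THE INDEX-GENERIC EDITION (§2, v1.1): THE `ℤᵈ` FRAME OF RECORD THROUGH A RE-INDEXING MAP `π : I → MemberZd θ.D θ.L`** — for `θ` with `2 ≤ θ.D`, `5 ≤ θ.L`:
Proposition 6 produces `c35₀, M₆ > 0` such that for every `c35 ≥ c35₀`, `M₃ ≥ M₆`, [4]'s letters `SLet ∕ SLetUB`, any index `I` with `π : I → MemberZd θ.D θ.L`, member map `mem`
with `π (mem M j m) = memZd M j m` at the admissible members, any `len`, any (3.8)-family `Gp` over `I`, any letter family `ops` with the pin `hops` (genuine `Q*aQ`, `Δ′`),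
N06's sentence `B9.Thm33Printed c35 (geoZd … ∘ π) (bgZd … ∘ π) Gp (GAZdFamOfOps … ops ∘ π)` OVER `I` (sound sub-indices are the consumer's choice — dag-n06-b LOCATED-SELF-7),
and the SIX junction binders at every `j : Node00.IdxB8SubD θ` give `∃ lam c₁ ρ₀ ax, 0 < c₁ ∧ 1 ≤ ρ₀ ∧ B8LeafOfRecordSubBP₂DPerκ θ Pκ Mκ Rκ ⟨lam.cutSubBP₅ c₁ ρ₀, ax⟩` (every period `Pκ`, every pinned pair `(Mκ, Rκ)`; dag-n05-w1's κ-cut periodic δ₂-slot).  Proof: dag-n05-e's `…_P6I` at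
`(geo, GA, ιLoc) := (geoZd ∘ π, GAZdFamOfOps ops ∘ π, id)`, `ops₀ := withDpZd ops₀`; `hcurv := curvAtInAk_of_Dp_eq`; `hdict` = the frame-of-record dictionary
`dictAt_of_global (dictGlob_zd …)` TRANSPORTED along `hmem` (the binder unfolded, `π (mem M j m)` rewritten to `memZd M j m`).  Hypotheses are N06 content; N05 NOT discharged.
[cite: Balaban1985RegularSpaces, Lemma 1 – Thm 8 pp.79–101, (1.3)–(1.5) p.77, (1.59) p.86; Balaban1985BackgroundPropagators, (3.10) p.392, (3.41) p.397, (3.47) p.398, Thm 3.3 p.399, (3.69) p.404] -/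
theorem exists_residB8_b8LeafOfRecordSubBP₂DPerκ_cutSubBP₅_of_letters_thm33_junctionH_zdFrameI_guarded (θ : Stage3Params) (hD : 2 ≤ θ.D) (hL5 : 5 ≤ θ.L)
    [FiniteDimensional ℝ θ.𝔸] :
    ∃ c35₀ M₆ : ℝ, 0 < c35₀ ∧ 0 < M₆ ∧
      ∀ ⦃c35 : ℝ⦄, c35₀ ≤ c35 → ∀ ⦃M₃ : ℝ⦄, M₆ ≤ M₃ →
      -- [Balaban1985BackgroundPropagators] Thm 3.1's letter bounds and threshold
      ∀ {B₀'H B₂' BG BR cL : ℝ}, 0 < B₀'H → 0 ≤ B₂' → 0 ≤ BG → 0 ≤ BR → 0 < cL →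
      -- [4]'s letters AT THE (1.3)–(1.5)-ADMISSIBLE `Ω₀ = ℤᵈ` LAW MEMBERS (p619291's texts verbatim): existence side and uniqueness side
      (∀ i : ZdIdx θ.D θ.L, i.Ω 0 = Set.univ → IdxB8LawsB θ.L i → B8ConstraintBonds.DomainSeq θ.L i.Ω → (∀ l, l < i.k → ∀ z ∈ i.Λs i.k l, ((θ.L : ℤ) ^ l) • z ∈ B8ConstraintBonds.Lam θ.L i.Ω l) → SockLettersRD (𝔸 := θ.𝔸) θ.L BG BR B₀'H B₂' cL i.η i.k i.Ω i.Λs) →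
      (∀ i : ZdIdx θ.D θ.L, i.Ω 0 = Set.univ → IdxB8LawsB θ.L i → B8ConstraintBonds.DomainSeq θ.L i.Ω → (∀ l, l < i.k → ∀ z ∈ i.Λs i.k l, ((θ.L : ℤ) ^ l) • z ∈ B8ConstraintBonds.Lam θ.L i.Ω l) → ∀ α₀ : ℝ, 0 < α₀ → α₀ ≤ cL → ∀ U₀ : Site θ.D → Fin θ.D → θ.𝔸ˣ, (∀ x κ, U₀ x κ ∈ unitaryUnits θ.𝔸) →
        InAk θ.L i.k i.η α₀ i.Ω U₀ →
        ∃ (g Δ : (Site θ.D → θ.𝔸) →ₗ[ℂ] (Site θ.D → θ.𝔸)) (q : (Site θ.D → θ.𝔸) →ₗ[ℂ] (ℕ → Site θ.D → θ.𝔸))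
          (qs : (ℕ → Site θ.D → θ.𝔸) →ₗ[ℂ] (Site θ.D → θ.𝔸)) (Aw c : (ℕ → Site θ.D → θ.𝔸) →ₗ[ℂ] (ℕ → Site θ.D → θ.𝔸))
          (H' : XSpace θ.D i.k θ.𝔸 →ₗ[ℂ] (Site θ.D → θ.𝔸)),
          (∀ x : Site θ.D → θ.𝔸, (∃ C : ℝ, ∀ y, ‖x y‖ ≤ C) → g (Δ x + qs (Aw (q x))) = x) ∧ (∀ φ, qs (c (q (g (g (qs φ))))) = qs φ) ∧
          (∀ (f : Site θ.D → θ.𝔸), ∀ x ∈ i.Ω 0, Δ f x = covLap i.η U₀ ((i.Ω 0).indicator f) x) ∧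
          (∀ (μ : ℕ → Site θ.D → θ.𝔸), ∀ x ∈ i.Ω 0, qs μ x = QT θ.L i.k (i.Λs i.k) U₀ μ x) ∧
          (∀ (f : Site θ.D → θ.𝔸) (n : ℕ), n ≤ i.k → ∀ y ∈ i.Λs i.k n, q f n y = QprimeIter (zdBlocking θ.D θ.L) (bgT θ.L U₀) n f y) ∧
          (∀ (f : Site θ.D → θ.𝔸) (n : ℕ) (y : Site θ.D), ¬ (n ≤ i.k ∧ y ∈ i.Λs i.k n) → q f n y = 0) ∧
          (∀ (X : XSpace θ.D i.k θ.𝔸) (x : Site θ.D), ‖H' X x‖ ≤ B₀'H * ‖X‖) ∧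
          (∀ n, n ≤ i.k → ∀ (X : XSpace θ.D i.k θ.𝔸), ∀ p ∈ {b : Site θ.D × Fin θ.D | SideTouches (i.Ω n) b.1 b.2},
            wt θ.L i.η n * ‖covDerivFwd i.η U₀ p.2 (H' X) p.1‖ ≤ B₀'H * ‖X‖) ∧
          (∀ X : XSpace θ.D i.k θ.𝔸, Bd2 θ.L i.η i.k i.Ω (covLap i.η U₀ (H' X)) (B₂' * ‖X‖)) ∧
          (∀ (Y : XSpace θ.D i.k θ.𝔸) (n : ℕ) (hn : n ≤ i.k) (y : Site θ.D), y ∈ i.Λs i.k n →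
            QprimeIter (zdBlocking θ.D θ.L) (bgT θ.L U₀) n (H' Y) y = Y (⟨n, Nat.lt_succ_of_le hn⟩, y)) ∧
          (∀ (f : Site θ.D → θ.𝔸) (r : ℝ), 0 ≤ r → Bd2 θ.L i.η i.k i.Ω f r →
            (∀ x, ‖g f x‖ ≤ BG * r) ∧ ∀ n, n ≤ i.k → ∀ p ∈ {b : Site θ.D × Fin θ.D | SideTouches (i.Ω n) b.1 b.2},
              wt θ.L i.η n * ‖covDerivFwd i.η U₀ p.2 (g f) p.1‖ ≤ BG * r) ∧
          (∀ (f : Site θ.D → θ.𝔸) (r : ℝ), 0 ≤ r → Bd2 θ.L i.η i.k i.Ω f r → Bd2 θ.L i.η i.k i.Ω (f - g (qs (c (q (g f))))) (BR * r))) →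
      -- ANY INDEX re-indexed into the `ℤᵈ` members of record by `π`, a member map landing on `memZd` at the admissible members, and N06's `ℤᵈ` FRAME OF RECORD
      -- READ THROUGH `π` (dag-n06-e): lengths `len`, geometries `geoZd ∘ π`, backgrounds `bgZd ∘ π`, the kernel family `GAZdFamOfOps … ops ∘ π` READ OFF the letters `ops`,
      -- locality map the identity; the (3.8)-side family `Gp` of Theorems 3.1–3.2 stays free (read by `Thm33Printed` only)
      ∀ {I : Type} (π : I → MemberZd θ.D θ.L) (len : Site θ.D → ℝ) (Gp : ∀ i, B9.KernelFamily (geoZd θ.𝔸 θ.L len (π i)) (bgZd θ.𝔸 θ.L (π i)))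
        (mem : ℝ → ZdIdx θ.D θ.L → ℕ → I),
        (∀ (M : ℝ) (j : IdxB8SubD θ) (m : ℕ), π (mem M j.1.1.1.1 m) = memZd M j.1.1.1.1 m) →
      ∀ (ops : ℝ → ZdIdx θ.D θ.L → ℕ → OpsZd θ.D θ.𝔸)
      -- THE GENUINE AVERAGING LETTER `Q*aQ` (EDITION P, dag-n06-b) AND THE GENUINE CURVATURE LETTER `Δ′(U₀)` (dag-n06-w2's `withDpZd`), pinned pointwise
        (τ : θ.𝔸 →ₗ[ℂ] ℂ) {Cτ : ℝ}, (∀ x y : θ.𝔸, |(τ (star x * y)).re| ≤ Cτ * ‖x‖ * ‖y‖) →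
      ∀ (ops₀ : ℝ → ZdIdx θ.D θ.L → ℕ → OpsZd θ.D θ.𝔸),
        (∀ (M : ℝ) (i : ZdIdx θ.D θ.L) (m : ℕ), ops M i m = withQQP τ θ.L (fun m' l => towerBondsP θ.L i.Ω (i.Λs m') l) (withDpZd ops₀) M i m) →
      ∀ {a₃ β cS cSβ : ℝ} {CH : ℝ → ℝ},
      -- N06's THEOREM 3.3 AS PRINTED — ITS NODE SENTENCE (γ) AT THE `ℤᵈ` FRAME OF RECORD READ THROUGH `π` (over `I`: sound sub-indices are the consumer's choice)
        B9.Thm33Printed c35 (fun i => geoZd θ.𝔸 θ.L len (π i)) (fun i => bgZd θ.𝔸 θ.L (π i)) Gp (fun i => GAZdFamOfOps θ.𝔸 θ.L len ops (π i)) →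
      -- dag-n06-b's JUNCTION BINDERS at the (1.3)–(1.5)-admissible members, guarded — SIX of them: NO `havg` (dag-n05-d g13 C), NO `hP6` (dag-n05-e), NO `hdict`, NO `hcurv` (this file)
        (∀ (M : ℝ) (j : IdxB8SubD θ) (m : ℕ), 1 ≤ M → M₃ ≤ M → m ≤ j.1.1.1.1.k → InvAtH (fun i => bgZd θ.𝔸 θ.L (π i)) θ.L mem (fun M i m U₀ hU₀ => ιCfgZd θ.𝔸 θ.L M i m U₀ hU₀) ops c35 a₃ M j.1.1.1.1 m) →
        (∀ (M : ℝ) (j : IdxB8SubD θ) (m : ℕ), 1 ≤ M → M₃ ≤ M → m ≤ j.1.1.1.1.k → LandauAt (fun i => bgZd θ.𝔸 θ.L (π i)) θ.L mem (fun M i m U₀ hU₀ => ιCfgZd θ.𝔸 θ.L M i m U₀ hU₀) ops c35 a₃ M j.1.1.1.1 m) →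
        (∀ (M : ℝ) (j : IdxB8SubD θ) (m : ℕ), 1 ≤ M → M₃ ≤ M → m ≤ j.1.1.1.1.k → HolderAtδ2 (fun i => geoZd θ.𝔸 θ.L len (π i)) (fun i => bgZd θ.𝔸 θ.L (π i)) (fun i => GAZdFamOfOps θ.𝔸 θ.L len ops (π i)) θ.L mem (fun M i m U₀ hU₀ => ιCfgZd θ.𝔸 θ.L M i m U₀ hU₀) ops β len CH M j.1.1.1.1 m) →
        (∀ (M : ℝ) (j : IdxB8SubD θ) (m : ℕ), 1 ≤ M → M₃ ≤ M → m ≤ j.1.1.1.1.k → LinBddAt θ.L ops M j.1.1.1.1 m) →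
        (∀ (M : ℝ) (j : IdxB8SubD θ) (m : ℕ), 1 ≤ M → M₃ ≤ M → m ≤ j.1.1.1.1.k → SrcAt (fun i => bgZd θ.𝔸 θ.L (π i)) θ.L mem (fun M i m U₀ hU₀ => ιCfgZd θ.𝔸 θ.L M i m U₀ hU₀) ops c35 a₃ cS M j.1.1.1.1 m) →
        (∀ (M : ℝ) (j : IdxB8SubD θ) (m : ℕ), 1 ≤ M → M₃ ≤ M → m ≤ j.1.1.1.1.k → SrcHolderAtδ2 (fun i => bgZd θ.𝔸 θ.L (π i)) θ.L mem (fun M i m U₀ hU₀ => ιCfgZd θ.𝔸 θ.L M i m U₀ hU₀) ops c35 a₃ β len cSβ M j.1.1.1.1 m) →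
      -- the junction's primitive constants ((3.27) `a₃`, source `c_S c_Sβ`; (3.69)'s `c69` is now `14(D−1)`, dag-n06-w2) and Theorem 8's source size factor `γ₈`
        0 < a₃ → 0 ≤ cS → 0 ≤ cSβ → ∀ {γ₈ : ℝ}, 1 ≤ γ₈ →
        ∀ (Pκ Mκ Rκ : ℕ), ∃ (lam : ResidB8 θ) (c₁ : ℝ) (ρ₀ : ℕ)
          (ax : ∀ j : IdxB8SubDPer θ Pκ, (famB8OfRecordPer θ (lam.cutSubBP₅ c₁ ρ₀).β (lam.cutSubBP₅ c₁ ρ₀).len Pκ j).Cfg →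
            (famB8OfRecordPer θ (lam.cutSubBP₅ c₁ ρ₀).β (lam.cutSubBP₅ c₁ ρ₀).len Pκ j).Pert → (famB8OfRecordPer θ (lam.cutSubBP₅ c₁ ρ₀).β (lam.cutSubBP₅ c₁ ρ₀).len Pκ j).Pert),
          0 < c₁ ∧ 1 ≤ ρ₀ ∧ B8LeafOfRecordSubBP₂DPerκ θ Pκ Mκ Rκ ⟨lam.cutSubBP₅ c₁ ρ₀, ax⟩ := by
  have hL1 : 1 ≤ θ.L := le_trans (by norm_num) hL5
  obtain ⟨c35₀, M₆, hc35₀, hM₆, H⟩ :=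
    exists_residB8_b8LeafOfRecordSubBP₂DPerκ_cutSubBP₅_of_letters_thm33_junctionH_withQQP_P6I_guarded θ hD hL5
  refine ⟨c35₀, M₆, hc35₀, hM₆, ?_⟩
  intro c35 hc35 M₃ hM₃ B₀'H B₂' BG BR cL hB₀'H hB₂' hBG hBR hcL SLet SLetUB I π len Gp mem hmem ops τ Cτ hCτ ops₀ hops a₃ β cS cSβ CH
    h33 hinv hlan hhol hlin hsrc hsrcH ha₃ hcS hcSβ γ₈ hγ₈ Pκ Mκ Rκ
  -- THE NORM DICTIONARY IS A THEOREM AT N06's FRAME OF RECORD, for THIS `ops` (dag-n06-e `dictGlob_zd`, read through `GAZdFamOfOps_eq`)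
  have hDG : DictGlob (geoZd θ.𝔸 θ.L len) (bgZd θ.𝔸 θ.L) (GAZdFamOfOps θ.𝔸 θ.L len ops) θ.L memZd (ιCfgZd θ.𝔸 θ.L) (ιLocZd θ.𝔸 θ.L len) ops := by
    rw [GAZdFamOfOps_eq]
    exact dictGlob_zd len ops _
  -- THE CURVATURE LETTER IS GENUINE AT EVERY MEMBER (the pin)
  have hDp : ∀ (M : ℝ) (i : ZdIdx θ.D θ.L) (m : ℕ), (ops M i m).Dp = DpZd i.η := fun M i m => by
    rw [hops, withQQP_Dp, withDpZd_Dp]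
  refine H hc35 hM₃ hB₀'H hB₂' hBG hBR hcL SLet SLetUB π (fun i => geoZd θ.𝔸 θ.L len (π i)) Gp (fun i => GAZdFamOfOps θ.𝔸 θ.L len ops (π i)) mem hmem
    (fun M i m J => J) ops τ hCτ (withDpZd ops₀) hops h33 ?_ hinv (fun M j m hM1 _ _ => curvAtInAk_of_Dp_eq hL1 hDp hM1 j.1.1.1.1 m) hlan hhol hlin hsrc hsrcH
    ha₃ (by positivity) hcS hcSβ hγ₈ Pκ Mκ Rκ
  -- `hdict` AT THE GENERIC INDEX: the frame-of-record dictionary at `memZd M j m`, transported along `hmem`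
  intro M j m _ _ _
  have h := dictAt_of_global hDG M j.1.1.1.1 m
  simp only [DictAt] at h ⊢
  rw [hmem M j m]
  exact h

end AtZdFrameIGuarded

section AtZdFrameSlot8κGuarded

/-- ★★★ **THE A-5′ (ii) λ-TERM's BODY AT N06's `ℤᵈ` FRAME OF RECORD, BY NAME** (dag-n24-w1 PRE-CLAIM-4 (R1) ∕ dag-n05-w1 WORD ∕ this seat's WORD, cell bus 2026-08-28
15:0x–15:09Z; director-ym №222 A-5′ (ii)): §5's hypotheses VERBATIM; at the outer-pinned pair `(Mκ, Rκ)` with `1 ≤ Mκ` the inner conclusion reads LITERALLY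
`∃ lam8, ∃ P c₁ ρ₀ ax, (0 < P ∧ Mκ * θ.L ∣ P) ∧ 0 < c₁ ∧ 1 ≤ ρ₀ ∧ B8LeafOfRecordSubBP₂DPerκ θ P Mκ Rκ ⟨lam8.cutSubBP₅ c₁ ρ₀, ax⟩` = `∃ lam8, Slot8κ Mκ Rκ θ lam8`
β-reduced — §5 at `Pκ := Mκ·θ.L` (`0 < P` from `1 ≤ Mκ`, `2 ≤ θ.L`).  The h05-side supplier shape the ONE Part-37 closer instance of A-5′ (ii) reads; the SIX binders +
`h33` remain N06 content at the ℤᵈ-keyed members; N05 NOT discharged.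
[cite: Balaban1985RegularSpaces, Lemma 1 – Thm 8 pp.79–101, (1.3)–(1.5) p.77, p.77 («Ω_j ⊂ T_η»); Balaban1985BackgroundPropagators, (3.10) p.392, Thm 3.3 p.399, (3.69) p.404] -/
theorem exists_residB8_slot8κ_of_letters_thm33_junctionH_zdFrame_guarded (θ : Stage3Params) (hD : 2 ≤ θ.D) (hL5 : 5 ≤ θ.L)
    [FiniteDimensional ℝ θ.𝔸] :
    ∃ c35₀ M₆ : ℝ, 0 < c35₀ ∧ 0 < M₆ ∧
      ∀ ⦃c35 : ℝ⦄, c35₀ ≤ c35 → ∀ ⦃M₃ : ℝ⦄, M₆ ≤ M₃ →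
      -- [Balaban1985BackgroundPropagators] Thm 3.1's letter bounds and threshold
      ∀ {B₀'H B₂' BG BR cL : ℝ}, 0 < B₀'H → 0 ≤ B₂' → 0 ≤ BG → 0 ≤ BR → 0 < cL →
      -- [4]'s letters AT THE (1.3)–(1.5)-ADMISSIBLE `Ω₀ = ℤᵈ` LAW MEMBERS (p619291's texts verbatim): existence side and uniqueness side
      (∀ i : ZdIdx θ.D θ.L, i.Ω 0 = Set.univ → IdxB8LawsB θ.L i → B8ConstraintBonds.DomainSeq θ.L i.Ω → (∀ l, l < i.k → ∀ z ∈ i.Λs i.k l, ((θ.L : ℤ) ^ l) • z ∈ B8ConstraintBonds.Lam θ.L i.Ω l) → SockLettersRD (𝔸 := θ.𝔸) θ.L BG BR B₀'H B₂' cL i.η i.k i.Ω i.Λs) →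
      (∀ i : ZdIdx θ.D θ.L, i.Ω 0 = Set.univ → IdxB8LawsB θ.L i → B8ConstraintBonds.DomainSeq θ.L i.Ω → (∀ l, l < i.k → ∀ z ∈ i.Λs i.k l, ((θ.L : ℤ) ^ l) • z ∈ B8ConstraintBonds.Lam θ.L i.Ω l) → ∀ α₀ : ℝ, 0 < α₀ → α₀ ≤ cL → ∀ U₀ : Site θ.D → Fin θ.D → θ.𝔸ˣ, (∀ x κ, U₀ x κ ∈ unitaryUnits θ.𝔸) →
        InAk θ.L i.k i.η α₀ i.Ω U₀ →
        ∃ (g Δ : (Site θ.D → θ.𝔸) →ₗ[ℂ] (Site θ.D → θ.𝔸)) (q : (Site θ.D → θ.𝔸) →ₗ[ℂ] (ℕ → Site θ.D → θ.𝔸))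
          (qs : (ℕ → Site θ.D → θ.𝔸) →ₗ[ℂ] (Site θ.D → θ.𝔸)) (Aw c : (ℕ → Site θ.D → θ.𝔸) →ₗ[ℂ] (ℕ → Site θ.D → θ.𝔸))
          (H' : XSpace θ.D i.k θ.𝔸 →ₗ[ℂ] (Site θ.D → θ.𝔸)),
          (∀ x : Site θ.D → θ.𝔸, (∃ C : ℝ, ∀ y, ‖x y‖ ≤ C) → g (Δ x + qs (Aw (q x))) = x) ∧ (∀ φ, qs (c (q (g (g (qs φ))))) = qs φ) ∧
          (∀ (f : Site θ.D → θ.𝔸), ∀ x ∈ i.Ω 0, Δ f x = covLap i.η U₀ ((i.Ω 0).indicator f) x) ∧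
          (∀ (μ : ℕ → Site θ.D → θ.𝔸), ∀ x ∈ i.Ω 0, qs μ x = QT θ.L i.k (i.Λs i.k) U₀ μ x) ∧
          (∀ (f : Site θ.D → θ.𝔸) (n : ℕ), n ≤ i.k → ∀ y ∈ i.Λs i.k n, q f n y = QprimeIter (zdBlocking θ.D θ.L) (bgT θ.L U₀) n f y) ∧
          (∀ (f : Site θ.D → θ.𝔸) (n : ℕ) (y : Site θ.D), ¬ (n ≤ i.k ∧ y ∈ i.Λs i.k n) → q f n y = 0) ∧
          (∀ (X : XSpace θ.D i.k θ.𝔸) (x : Site θ.D), ‖H' X x‖ ≤ B₀'H * ‖X‖) ∧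
          (∀ n, n ≤ i.k → ∀ (X : XSpace θ.D i.k θ.𝔸), ∀ p ∈ {b : Site θ.D × Fin θ.D | SideTouches (i.Ω n) b.1 b.2},
            wt θ.L i.η n * ‖covDerivFwd i.η U₀ p.2 (H' X) p.1‖ ≤ B₀'H * ‖X‖) ∧
          (∀ X : XSpace θ.D i.k θ.𝔸, Bd2 θ.L i.η i.k i.Ω (covLap i.η U₀ (H' X)) (B₂' * ‖X‖)) ∧
          (∀ (Y : XSpace θ.D i.k θ.𝔸) (n : ℕ) (hn : n ≤ i.k) (y : Site θ.D), y ∈ i.Λs i.k n →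
            QprimeIter (zdBlocking θ.D θ.L) (bgT θ.L U₀) n (H' Y) y = Y (⟨n, Nat.lt_succ_of_le hn⟩, y)) ∧
          (∀ (f : Site θ.D → θ.𝔸) (r : ℝ), 0 ≤ r → Bd2 θ.L i.η i.k i.Ω f r →
            (∀ x, ‖g f x‖ ≤ BG * r) ∧ ∀ n, n ≤ i.k → ∀ p ∈ {b : Site θ.D × Fin θ.D | SideTouches (i.Ω n) b.1 b.2},
              wt θ.L i.η n * ‖covDerivFwd i.η U₀ p.2 (g f) p.1‖ ≤ BG * r) ∧
          (∀ (f : Site θ.D → θ.𝔸) (r : ℝ), 0 ≤ r → Bd2 θ.L i.η i.k i.Ω f r → Bd2 θ.L i.η i.k i.Ω (f - g (qs (c (q (g f))))) (BR * r))) →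
      -- N06's `ℤᵈ` FRAME OF RECORD (dag-n06-e): lengths `len`, geometries `geoZd`, backgrounds `bgZd`, the kernel family `GAZdFamOfOps … ops` READ OFF the letters `ops`
      -- (dag-n06-e's `B9SupplySockB9P3ZdLocalLettersOfOps`), locality map `ιLocZd`; the (3.8)-side family `Gp` of Theorems 3.1–3.2 stays free (read by `Thm33Printed` only)
      ∀ (len : Site θ.D → ℝ) (Gp : ∀ x, B9.KernelFamily (geoZd θ.𝔸 θ.L len x) (bgZd θ.𝔸 θ.L x))
        (ops : ℝ → ZdIdx θ.D θ.L → ℕ → OpsZd θ.D θ.𝔸)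
      -- THE GENUINE AVERAGING LETTER `Q*aQ` (EDITION P, dag-n06-b) AND THE GENUINE CURVATURE LETTER `Δ′(U₀)` (dag-n06-w2's `withDpZd`), pinned pointwise
        (τ : θ.𝔸 →ₗ[ℂ] ℂ) {Cτ : ℝ}, (∀ x y : θ.𝔸, |(τ (star x * y)).re| ≤ Cτ * ‖x‖ * ‖y‖) →
      ∀ (ops₀ : ℝ → ZdIdx θ.D θ.L → ℕ → OpsZd θ.D θ.𝔸),
        (∀ (M : ℝ) (i : ZdIdx θ.D θ.L) (m : ℕ), ops M i m = withQQP τ θ.L (fun m' l => towerBondsP θ.L i.Ω (i.Λs m') l) (withDpZd ops₀) M i m) →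
      ∀ {a₃ β cS cSβ : ℝ} {CH : ℝ → ℝ},
      -- N06's THEOREM 3.3 AS PRINTED — ITS NODE SENTENCE (γ) AT THE `ℤᵈ` FRAME OF RECORD, VERBATIM (the kernel family of `G(U₀)` read off `ops`)
        B9.Thm33Printed c35 (geoZd θ.𝔸 θ.L len) (bgZd θ.𝔸 θ.L) Gp (GAZdFamOfOps θ.𝔸 θ.L len ops) →
      -- dag-n06-b's JUNCTION BINDERS at the (1.3)–(1.5)-admissible members, guarded — SIX of them: NO `havg` (dag-n05-d g13 C), NO `hP6` (dag-n05-e), NO `hdict`, NO `hcurv` (this file)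
        (∀ (M : ℝ) (j : IdxB8SubD θ) (m : ℕ), 1 ≤ M → M₃ ≤ M → m ≤ j.1.1.1.1.k → InvAtH (bgZd θ.𝔸 θ.L) θ.L memZd (ιCfgZd θ.𝔸 θ.L) ops c35 a₃ M j.1.1.1.1 m) →
        (∀ (M : ℝ) (j : IdxB8SubD θ) (m : ℕ), 1 ≤ M → M₃ ≤ M → m ≤ j.1.1.1.1.k → LandauAt (bgZd θ.𝔸 θ.L) θ.L memZd (ιCfgZd θ.𝔸 θ.L) ops c35 a₃ M j.1.1.1.1 m) →
        (∀ (M : ℝ) (j : IdxB8SubD θ) (m : ℕ), 1 ≤ M → M₃ ≤ M → m ≤ j.1.1.1.1.k → HolderAtδ2 (geoZd θ.𝔸 θ.L len) (bgZd θ.𝔸 θ.L) (GAZdFamOfOps θ.𝔸 θ.L len ops) θ.L memZd (ιCfgZd θ.𝔸 θ.L) ops β len CH M j.1.1.1.1 m) →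
        (∀ (M : ℝ) (j : IdxB8SubD θ) (m : ℕ), 1 ≤ M → M₃ ≤ M → m ≤ j.1.1.1.1.k → LinBddAt θ.L ops M j.1.1.1.1 m) →
        (∀ (M : ℝ) (j : IdxB8SubD θ) (m : ℕ), 1 ≤ M → M₃ ≤ M → m ≤ j.1.1.1.1.k → SrcAt (bgZd θ.𝔸 θ.L) θ.L memZd (ιCfgZd θ.𝔸 θ.L) ops c35 a₃ cS M j.1.1.1.1 m) →
        (∀ (M : ℝ) (j : IdxB8SubD θ) (m : ℕ), 1 ≤ M → M₃ ≤ M → m ≤ j.1.1.1.1.k → SrcHolderAtδ2 (bgZd θ.𝔸 θ.L) θ.L memZd (ιCfgZd θ.𝔸 θ.L) ops c35 a₃ β len cSβ M j.1.1.1.1 m) →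
      -- the junction's primitive constants ((3.27) `a₃`, source `c_S c_Sβ`; (3.69)'s `c69` is now `14(D−1)`, dag-n06-w2) and Theorem 8's source size factor `γ₈`
        0 < a₃ → 0 ≤ cS → 0 ≤ cSβ → ∀ {γ₈ : ℝ}, 1 ≤ γ₈ →
        ∀ (Mκ Rκ : ℕ), 1 ≤ Mκ → ∃ (lam8 : ResidB8 θ) (P : ℕ) (c₁ : ℝ) (ρ₀ : ℕ)
          (ax : ∀ j : IdxB8SubDPer θ P, (famB8OfRecordPer θ (lam8.cutSubBP₅ c₁ ρ₀).β (lam8.cutSubBP₅ c₁ ρ₀).len P j).Cfg →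
            (famB8OfRecordPer θ (lam8.cutSubBP₅ c₁ ρ₀).β (lam8.cutSubBP₅ c₁ ρ₀).len P j).Pert → (famB8OfRecordPer θ (lam8.cutSubBP₅ c₁ ρ₀).β (lam8.cutSubBP₅ c₁ ρ₀).len P j).Pert),
          (0 < P ∧ Mκ * θ.L ∣ P) ∧ 0 < c₁ ∧ 1 ≤ ρ₀ ∧ B8LeafOfRecordSubBP₂DPerκ θ P Mκ Rκ ⟨lam8.cutSubBP₅ c₁ ρ₀, ax⟩ := by
  obtain ⟨c35₀, M₆, hc35₀, hM₆, H⟩ := exists_residB8_b8LeafOfRecordSubBP₂DPerκ_cutSubBP₅_of_letters_thm33_junctionH_zdFrame_guarded θ hD hL5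
  refine ⟨c35₀, M₆, hc35₀, hM₆, ?_⟩
  intro c35 hc35 M₃ hM₃ B₀'H B₂' BG BR cL hB₀'H hB₂' hBG hBR hcL SLet SLetUB len Gp ops τ Cτ hCτ ops₀ hops a₃ β cS cSβ CH
    h33 hinv hlan hhol hlin hsrc hsrcH ha₃ hcS hcSβ γ₈ hγ₈ Mκ Rκ hMκ
  obtain ⟨lam, c₁, ρ₀, ax, hc₁, hρ₀, h⟩ := H hc35 hM₃ hB₀'H hB₂' hBG hBR hcL SLet SLetUB len Gp ops τ hCτ ops₀ hops h33 hinv hlan hhol hlin hsrc hsrcH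
    ha₃ hcS hcSβ hγ₈ (Mκ * θ.L) Mκ Rκ
  have hL1 : 1 ≤ θ.L := le_trans one_le_two θ.two_le_L
  exact ⟨lam, Mκ * θ.L, c₁, ρ₀, ax, ⟨Nat.mul_pos (Nat.lt_of_lt_of_le Nat.zero_lt_one hMκ) (Nat.lt_of_lt_of_le Nat.zero_lt_one hL1), dvd_rfl⟩, hc₁, hρ₀, h⟩

end AtZdFrameSlot8κGuarded

end Summit.QuantumFields.YangMills.BalabanUVNodes.N05SubBP2DPerKappaSlotExistsOfThm33JunctionHAtZdFrameGuarded

end
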